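import Summits.BirchSwinnertonDyer.BirchSwinnertonDyer.Theorems.Rank1ResidualX1Isogeny
import Literature.NumberTheory.EllipticCurves.CasselsTateIsogenyAdjoint
import HarnessLib

/-!
# Class X1, per pair: `BSD(E,p)` from an isogeny-descent datum `Ш(E)[φ] = 0` and a Cassels–Tate
# NON-DEGENERACY certificate on `Ш(E′)[φ̂]` (the shape that closes 15834t1@5)

HONEST FRAMING (cell `b2b-bsdres`, run/shared/lean/b2b/bsd-rank1-residual/, verbatim in every
file): the goal of the cell is to DELETE the COMBINATION-SHAPED residual classes of the
Birch–Swinnerton-Dyer formula for ALL analytic-rank `≤ 1` elliptic curves over `ℚ` — "full BSD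
formula for every rank `≤ 1` curve in class `C`" assembled STRICTLY from published theorems — so
that the rank-`≤ 1` remainder becomes exactly the CONSTRUCTION-SHAPED classes, which are TYPED
(missing-input `Prop`s), NOT attempted. This is not "finishing BSD". Unit `b2b-bsdres-x1b`
(prover B, the independent patchwork), gen 7. THEOREMS ONLY (no definition, no named fact); a
per-pair certificate CONSUMER, not a class theorem.

**Why.** On the census of record (N < 2·10⁴) exactly ONE X1 pair is left 'open after' by the
lane (RESIDUAL-CASES v25–v29): `15834t1 @ 5`, analytic rank `1`. Both explicit `5`-isogeny descents
of the cell (`φ : E → E′ = E/⟨T⟩`, `T` the rational `5`-torsion point of `E = 15834t1`,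
`E′ = 15834t2`, `ψ = φ̂`) give `Ш(E)[φ] = 0` but `Ш(E′)[ψ] ≅ (ℤ/5)²` (`#Ш_an(E′) = 25`,
`#Ш_an(E) = 1`): the first descent cannot decide whether `Ш(E)[5]`, which `Ш(φ)` embeds into
`Ш(E′)[ψ]`, vanishes — so the consumer of the 712 booked pairs, `X1.bsdp_of_noPTorsion`
(`Ш(E)[p] = 0 ⇒ BSDp`, Gross–Zagier–Kolyvagin only), did not apply. The missing bit is
supplied by the CASSELS–TATE PAIRING: by the functoriality (adjointness) of the pairing under the
dual pair `(φ, ψ)` — Cassels 1962/1965, Milne *ADT* I Rem. 6.10(a), the tree's named fact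
`exists_casselsTate_pairing_adjoint` — the image `Ш(φ)(Ш(E))` is orthogonal to `ker Ш(ψ) = Ш(E′)[ψ]`;
hence if the (alternating) pairing is NON-DEGENERATE on `Ш(E′)[ψ]`, then `Ш(φ)` kills `Ш(E)[deg φ]`,
i.e. `Ш(E)[p] ⊆ Ш(E)[φ] = 0`. (This is the easy half of Fisher, J. Number Theory 98 (2003) Thm. 3:
"`x ∈ Ш(D/K)` belongs to the image of `φ : Ш(C/K) → Ш(D/K)` iff `⟨x, y⟩ = 0` for all
`y ∈ Ш(D/K)[φ̂]`".) The cell's engines `ctp5` / `ctp5b` (x1b gen 7; Fisher's Prop. 2.9 over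
`ℚ(E[5])` with corestriction from `ℚ(ζ₅)`, resp. an explicit Heisenberg-extension lift over `ℚ(ζ₅)`)
compute that pairing on `Ш(15834t2)[ψ]` and find it non-degenerate, by two different methods
(`HOME/b2b-bsdres-x1b/gen7/ctp5/CERT-X1-15834t-CT5.md`). This file is the KERNEL form of the
deduction, so that the booking shape reads: PUBLISHED facts (Gross–Zagier–Kolyvagin; Cassels'
isogeny invariance; the Cassels–Tate pairing with its functoriality, Milne I.6.9/6.10/6.13) +
a finite certificate (`Ш(E)[φ] = 0` two-engine; non-degeneracy of the pairing on `Ш(E′)[ψ]`).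

**This file proves**
* `sha_torsion_eq_zero_of_adjoint_of_nondegenerate` — pure algebra on `Ш`, any number field:
  for a dual pair `ψ ∘ φ = [deg φ]`, ANY bi-additive `B`, `B′` with `B′ (Ш(φ) a) b = B a (Ш(ψ) b)`,
  if `Ш(φ)` is injective and `B′` is non-degenerate on `ker Ш(ψ)`, then `Ш(E)[deg φ] = 0`;
* `bsdp_of_shaMap_injective_of_casselsTate_nondegenerate` — canonical shape
  `r_an ≤ 1 → ClassX1 W p → p ∤ #Ш_an(W) → (φ, ψ, B, B′ as above, deg φ = p) → BSDp W p`
  (via `X1.bsdp_of_noPTorsion`);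
* `bsdp_pair_of_shaMap_injective_of_casselsTate_nondegenerate` — also `BSDp W′ p` for the
  isogenous curve (Cassels, `bsdp_iff_of_isIsogenous`);
* `bsdp_of_casselsTate_adjoint_certificate` — the same with `(B, B′)` taken from the named fact
  `exists_casselsTate_pairing_adjoint ℚ` (Milne I.6.9/6.10/6.13) and the certificate phrased for
  EVERY adjoint pair of pairings with the fact's properties (the form a sceptic may prefer: it does
  not presuppose which pairing the engine computed; it is implied by uniqueness statements we do not
  formalise, and is what the engine's method — Cassels' own construction — certifies).

References: Cassels, *Arithmetic on curves of genus 1* IV (1962), VIII (1965); Milne, *ADT* I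
Prop. 6.9, Rem. 6.10(a), Thm. 6.13(a) [MilneADT2006]; Fisher, J. Number Theory 98 (2003) 105–155,
Thm. 3 (p. 123), Prop. 2.9 (p. 126), Prop. 2.16 (p. 132); McCallum, Invent. Math. 93 (1988);
Gross–Zagier 1986 / Kolyvagin 1990 (bsd.S17); Miller 2011 Def. 1.1 [Miller2011LMS]; cell files
`b2b-bsdres-x1b/X1-B.md` §12, `gen7/ctp5/CERT-X1-15834t-CT5.md`.
-/

set_option autoImplicit false

noncomputable section

open scoped Classical

open WeierstrassCurve Literature.NumberTheory.EllipticCurves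
  Literature.NumberTheory.EllipticCurves.Rank1Residual

universe u

namespace Summit.BirchSwinnertonDyer.Rank1Residual.X1.CasselsTateIsogenyCertificate

section Algebra

variable {K : Type u} [Field K] [NumberField K] {W W' : WeierstrassCurve K}

/-- **`Ш(E)[deg φ] = 0` from an injective `Ш(φ)` and a pairing non-degenerate on `Ш(E′)[φ̂]`.**
Let `φ : E → E′`, `ψ : E′ → E` be a dual pair of isogenies over a number field (`ψ ∘ φ = [deg φ]`),
and let `B`, `B′` be bi-additive `ℚ/ℤ`-valued pairings on `Ш(E)`, `Ш(E′)` for which `Ш(φ)` and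
`Ш(ψ)` are ADJOINT, `B′ (Ш(φ) a) b = B a (Ш(ψ) b)` (the Cassels–Tate pairings have this property:
Milne *ADT* I Rem. 6.10(a), the tree's `exists_casselsTate_pairing_adjoint`). If `Ш(φ)` is
injective (`Ш(E)[φ] = 0`) and `B′` restricted to `ker Ш(ψ) = Ш(E′)[ψ]` is non-degenerate, then
`Ш(E)` has no element of order `deg φ`: for `z` with `(deg φ) • z = 0`, `x := Ш(φ) z` lies in
`ker Ш(ψ)` (`Ш(ψ)(Ш(φ) z) = (deg φ) • z = 0`, `galH1Map_galH1Map_of_comp_eq_nsmul`) and is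
orthogonal to `ker Ш(ψ)` by adjointness (`B′ x y = B z (Ш(ψ) y) = 0`), so `x = 0`, so `z = 0`.
The easy half of Fisher, J. Number Theory 98 (2003) Thm. 3.
[cite: MilneADT2006, Ch. I Remark 6.10(a)] -/
theorem sha_torsion_eq_zero_of_adjoint_of_nondegenerate (φ : Isogeny W W') (ψ : Isogeny W' W)
    (hψφ : ∀ P : W.geomPoints, ψ (φ P) = (φ.degree : ℤ) • P)
    (B : W.sha →+ W.sha →+ AddCircle (1 : ℚ)) (B' : W'.sha →+ W'.sha →+ AddCircle (1 : ℚ))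
    (hadj : ∀ a b, B' (shaMap φ.toAddMonoidHom φ.equivariant φ.hasLocalPointsMaps_toAddMonoidHom a) b =
      B a (shaMap ψ.toAddMonoidHom ψ.equivariant ψ.hasLocalPointsMaps_toAddMonoidHom b))
    (hinj : ∀ z : W.sha,
      shaMap φ.toAddMonoidHom φ.equivariant φ.hasLocalPointsMaps_toAddMonoidHom z = 0 → z = 0)
    (hND : ∀ x : W'.sha,
      shaMap ψ.toAddMonoidHom ψ.equivariant ψ.hasLocalPointsMaps_toAddMonoidHom x = 0 →
        (∀ y : W'.sha,
          shaMap ψ.toAddMonoidHom ψ.equivariant ψ.hasLocalPointsMaps_toAddMonoidHom y = 0 →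
            B' x y = 0) → x = 0) :
    ∀ z : W.sha, (φ.degree : ℤ) • z = 0 → z = 0 := by
  intro z hz
  set Φ := shaMap φ.toAddMonoidHom φ.equivariant φ.hasLocalPointsMaps_toAddMonoidHom with hΦ
  set Ψ := shaMap ψ.toAddMonoidHom ψ.equivariant ψ.hasLocalPointsMaps_toAddMonoidHom with hΨ
  have hcomp : Ψ (Φ z) = φ.degree • z := by
    apply Subtype.ext
    rw [hΨ, hΦ, coe_shaMap_apply, coe_shaMap_apply, AddSubgroupClass.coe_nsmul]
    exact galH1Map_galH1Map_of_comp_eq_nsmul φ.toAddMonoidHom φ.equivariant ψ.toAddMonoidHom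
      ψ.equivariant hψφ (z : W.galH1)
  have hz' : φ.degree • z = 0 := by rwa [← natCast_zsmul]
  have hx : Ψ (Φ z) = 0 := by rw [hcomp, hz']
  have hperp : ∀ y : W'.sha, Ψ y = 0 → B' (Φ z) y = 0 := fun y hy ↦ by
    rw [hadj, hy, map_zero]
  exact hinj z (hND (Φ z) hx hperp)

end Algebra

section Rat

variable {W W' : WeierstrassCurve ℚ}

/-- **Class X1, per pair (the 15834t1@5 shape): `BSD(E,p)` from `Ш(E)[φ] = 0` and the
non-degeneracy of the Cassels–Tate pairing on `Ш(E′)[φ̂]`.** Canonical shape: for a globally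
minimal elliptic `W/ℚ` with `r_an ≤ 1` in class X1 at `p`, with `p ∤ #Ш_an(W)`, a dual pair
`φ : W → W′`, `ψ : W′ → W` of degree `p` (`ψ ∘ φ = [p]`), pairings `B`, `B′` on `Ш(W)`, `Ш(W′)`
making `Ш(φ)`, `Ш(ψ)` adjoint (the Cassels–Tate pairings, Milne *ADT* I.6.9/6.10 —
`exists_casselsTate_pairing_adjoint ℚ`), the CERTIFICATE "`Ш(φ)` injective (first descent) and `B′`
non-degenerate on `Ш(W′)[ψ]` (Cassels–Tate computation)" gives `Ш(W)[p] = 0`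
(`sha_torsion_eq_zero_of_adjoint_of_nondegenerate`), whence `BSDp W p` by
`Rank1Residual.X1.bsdp_of_noPTorsion` (Gross–Zagier–Kolyvagin `hGZK` only). The class hypothesis is
carried, not used (as in `X1.bsdp_of_noPTorsion`). [cite: Miller2011LMS, §1 Def. 1.1]
[cite: MilneADT2006, Ch. I Remark 6.10(a)] -/
theorem bsdp_of_shaMap_injective_of_casselsTate_nondegenerate
    (hGZK : rank_eq_analyticRank_of_analyticRank_le_one)
    (W W' : WeierstrassCurve ℚ) [W.IsElliptic] [W'.IsElliptic] [W.IsGloballyMinimal]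
    (p : ℕ) [Fact p.Prime] (hr : W.analyticRank ≤ 1) (hX : ClassX1 W p)
    {q : ℚ} (hq : shaAn W = (q : ℂ)) (hv : padicValRat p q = 0)
    (φ : Isogeny W W') (ψ : Isogeny W' W)
    (hψφ : ∀ P : W.geomPoints, ψ (φ P) = (φ.degree : ℤ) • P) (hdeg : φ.degree = p)
    (B : W.sha →+ W.sha →+ AddCircle (1 : ℚ)) (B' : W'.sha →+ W'.sha →+ AddCircle (1 : ℚ))
    (hadj : ∀ a b, B' (shaMap φ.toAddMonoidHom φ.equivariant φ.hasLocalPointsMaps_toAddMonoidHom a) b =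
      B a (shaMap ψ.toAddMonoidHom ψ.equivariant ψ.hasLocalPointsMaps_toAddMonoidHom b))
    (hinj : ∀ z : W.sha,
      shaMap φ.toAddMonoidHom φ.equivariant φ.hasLocalPointsMaps_toAddMonoidHom z = 0 → z = 0)
    (hND : ∀ x : W'.sha,
      shaMap ψ.toAddMonoidHom ψ.equivariant ψ.hasLocalPointsMaps_toAddMonoidHom x = 0 →
        (∀ y : W'.sha,
          shaMap ψ.toAddMonoidHom ψ.equivariant ψ.hasLocalPointsMaps_toAddMonoidHom y = 0 →
            B' x y = 0) → x = 0) :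
    BSDp W p := by
  refine X1.bsdp_of_noPTorsion hGZK W p hr hX hq hv ?_
  intro x hx
  refine sha_torsion_eq_zero_of_adjoint_of_nondegenerate φ ψ hψφ B B' hadj hinj hND x ?_
  rwa [hdeg]

/-- **Both curves of the pair.** Under the hypotheses of
`bsdp_of_shaMap_injective_of_casselsTate_nondegenerate`, with `W′` globally minimal as well,
also `BSDp W′ p` — Cassels' isogeny invariance of the BSD quotient at analytic rank `≤ 1`
(`bsdp_iff_of_isIsogenous`, binders `hmod` modularity and `hCassels` = Cassels 1965 / Milne *ADT*
I.7.3). For 15834t1@5 this reads: `BSD(15834t1, 5)` and `BSD(15834t2, 5)`.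
[cite: MilneADT2006, Ch. I Thm. 7.3] [cite: Miller2011LMS, §1 Def. 1.1] -/
theorem bsdp_pair_of_shaMap_injective_of_casselsTate_nondegenerate
    (hGZK : rank_eq_analyticRank_of_analyticRank_le_one)
    (hmod : hasEntireLFunction_rat) (hCassels : bsdRHS_eq_of_isIsogenous)
    (W W' : WeierstrassCurve ℚ) [W.IsElliptic] [W'.IsElliptic] [W.IsGloballyMinimal]
    [W'.IsGloballyMinimal] (p : ℕ) [Fact p.Prime] (hr : W.analyticRank ≤ 1) (hX : ClassX1 W p)
    {q : ℚ} (hq : shaAn W = (q : ℂ)) (hv : padicValRat p q = 0)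
    (φ : Isogeny W W') (ψ : Isogeny W' W)
    (hψφ : ∀ P : W.geomPoints, ψ (φ P) = (φ.degree : ℤ) • P) (hdeg : φ.degree = p)
    (B : W.sha →+ W.sha →+ AddCircle (1 : ℚ)) (B' : W'.sha →+ W'.sha →+ AddCircle (1 : ℚ))
    (hadj : ∀ a b, B' (shaMap φ.toAddMonoidHom φ.equivariant φ.hasLocalPointsMaps_toAddMonoidHom a) b =
      B a (shaMap ψ.toAddMonoidHom ψ.equivariant ψ.hasLocalPointsMaps_toAddMonoidHom b))
    (hinj : ∀ z : W.sha,
      shaMap φ.toAddMonoidHom φ.equivariant φ.hasLocalPointsMaps_toAddMonoidHom z = 0 → z = 0)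
    (hND : ∀ x : W'.sha,
      shaMap ψ.toAddMonoidHom ψ.equivariant ψ.hasLocalPointsMaps_toAddMonoidHom x = 0 →
        (∀ y : W'.sha,
          shaMap ψ.toAddMonoidHom ψ.equivariant ψ.hasLocalPointsMaps_toAddMonoidHom y = 0 →
            B' x y = 0) → x = 0) :
    BSDp W p ∧ BSDp W' p := by
  have hB : BSDp W p := bsdp_of_shaMap_injective_of_casselsTate_nondegenerate hGZK W W' p hr hX
    hq hv φ ψ hψφ hdeg B B' hadj hinj hND
  refine ⟨hB, ?_⟩
  have hiso : IsIsogenous W W' := ⟨φ⟩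
  exact (Summit.BirchSwinnertonDyer.BirchSwinnertonDyer.Theorems.Rank1ResidualX1Isogeny.bsdp_iff_of_isIsogenous
    hGZK hmod hCassels W W' hiso p hr).mp hB

/-- **The same consumer with the pairings SUPPLIED by the named fact** `exists_casselsTate_pairing_adjoint ℚ`
(Cassels 1962/1965; Milne *ADT* I Prop. 6.9, Rem. 6.10(a),(b), Thm. 6.13(a)) and the certificate
phrased over EVERY adjoint pair of alternating pairings whose kernels are the divisible elements:
`r_an ≤ 1 → ClassX1 W p → p ∤ #Ш_an(W) → (φ, ψ dual of degree p) → Ш(φ) injective →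
(every such B′ is non-degenerate on Ш(W′)[ψ]) → BSDp W p`. [cite: MilneADT2006, Ch. I Prop. 6.9,
Remark 6.10(a), Thm. 6.13(a)] [cite: Miller2011LMS, §1 Def. 1.1] -/
theorem bsdp_of_casselsTate_adjoint_certificate
    (hGZK : rank_eq_analyticRank_of_analyticRank_le_one) (hCT : exists_casselsTate_pairing_adjoint ℚ)
    (W W' : WeierstrassCurve ℚ) [W.IsElliptic] [W'.IsElliptic] [W.IsGloballyMinimal]
    (p : ℕ) [Fact p.Prime] (hr : W.analyticRank ≤ 1) (hX : ClassX1 W p)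
    {q : ℚ} (hq : shaAn W = (q : ℂ)) (hv : padicValRat p q = 0)
    (φ : Isogeny W W') (ψ : Isogeny W' W)
    (hψφ : ∀ P : W.geomPoints, ψ (φ P) = (φ.degree : ℤ) • P) (hdeg : φ.degree = p)
    (hinj : ∀ z : W.sha,
      shaMap φ.toAddMonoidHom φ.equivariant φ.hasLocalPointsMaps_toAddMonoidHom z = 0 → z = 0)
    (hcert : ∀ (B : W.sha →+ W.sha →+ AddCircle (1 : ℚ)) (B' : W'.sha →+ W'.sha →+ AddCircle (1 : ℚ)),
      (∀ x, B x x = 0) → (∀ x, (∀ y, B x y = 0) ↔ x ∈ AddSubgroup.divisibleElements W.sha) →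
      (∀ x, B' x x = 0) → (∀ x, (∀ y, B' x y = 0) ↔ x ∈ AddSubgroup.divisibleElements W'.sha) →
      (∀ a b, B' (shaMap φ.toAddMonoidHom φ.equivariant φ.hasLocalPointsMaps_toAddMonoidHom a) b =
        B a (shaMap ψ.toAddMonoidHom ψ.equivariant ψ.hasLocalPointsMaps_toAddMonoidHom b)) →
      ∀ x : W'.sha,
        shaMap ψ.toAddMonoidHom ψ.equivariant ψ.hasLocalPointsMaps_toAddMonoidHom x = 0 →
          (∀ y : W'.sha,
            shaMap ψ.toAddMonoidHom ψ.equivariant ψ.hasLocalPointsMaps_toAddMonoidHom y = 0 →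
              B' x y = 0) → x = 0) :
    BSDp W p := by
  obtain ⟨B, B', hBalt, hBker, hB'alt, hB'ker, hadj⟩ := hCT W W' φ ψ hψφ
  exact bsdp_of_shaMap_injective_of_casselsTate_nondegenerate hGZK W W' p hr hX hq hv φ ψ hψφ hdeg
    B B' hadj hinj (hcert B B' hBalt hBker hB'alt hB'ker hadj)

end Rat

section ClassFree

/-! ### Class-free forms (gen 7 addendum)

The deduction uses nothing about class X1: the same certificate shape closes `BSD(E,p)` for ANY
pair with `r_an ≤ 1`, `p ∤ #Ш_an(E)`, a rational `p`-isogeny `φ : E → E′` with `Ш(φ)` injective and the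
Cassels–Tate pairing non-degenerate on `Ш(E′)[φ̂]` — e.g. the cell's class-X3 pairs at an ADDITIVE
`p` (rank `0`, rational `p`-torsion, `#Ш_an(E′) = p²`: sha-2's RESISTANT (d) pairs 19950cv1@5,
5346r1@3, …), where Wuthrich's Prop. 21 is unavailable and the first descent finds `(ℤ/p)² ⊆ Ш(E′)[φ̂]`.
The consumer is the class-free `Typed.bsdp_of_shaAn_unit_of_noPTorsion` (x11b; Gross–Zagier–Kolyvagin
only). -/

variable {W W' : WeierstrassCurve ℚ}

/-- **Class-free form of `bsdp_of_shaMap_injective_of_casselsTate_nondegenerate`.** For an elliptic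
`W/ℚ` with `r_an ≤ 1` and `p ∤ #Ш_an(W)`, a dual pair `φ : W → W′`, `ψ : W′ → W` with `deg φ = p`,
bi-additive pairings `B`, `B′` on `Ш(W)`, `Ш(W′)` making `Ш(φ)`, `Ш(ψ)` adjoint (the Cassels–Tate
pairings: Milne *ADT* I Rem. 6.10(a), `exists_casselsTate_pairing_adjoint ℚ`), `Ш(φ)` injective and
`B′` non-degenerate on `ker Ш(ψ)`: `BSDp W p`, by `sha_torsion_eq_zero_of_adjoint_of_nondegenerate`
and `Typed.bsdp_of_shaAn_unit_of_noPTorsion`. No reduction-type or class hypothesis.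
[cite: Miller2011LMS, §1 Def. 1.1] [cite: MilneADT2006, Ch. I Remark 6.10(a)] -/
theorem bsdp_of_shaMap_injective_of_casselsTate_nondegenerate'
    (hGZK : rank_eq_analyticRank_of_analyticRank_le_one)
    (W W' : WeierstrassCurve ℚ) [W.IsElliptic] [W'.IsElliptic]
    (p : ℕ) [Fact p.Prime] (hr : W.analyticRank ≤ 1)
    {q : ℚ} (hq : shaAn W = (q : ℂ)) (hv : padicValRat p q = 0)
    (φ : Isogeny W W') (ψ : Isogeny W' W)
    (hψφ : ∀ P : W.geomPoints, ψ (φ P) = (φ.degree : ℤ) • P) (hdeg : φ.degree = p)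
    (B : W.sha →+ W.sha →+ AddCircle (1 : ℚ)) (B' : W'.sha →+ W'.sha →+ AddCircle (1 : ℚ))
    (hadj : ∀ a b, B' (shaMap φ.toAddMonoidHom φ.equivariant φ.hasLocalPointsMaps_toAddMonoidHom a) b =
      B a (shaMap ψ.toAddMonoidHom ψ.equivariant ψ.hasLocalPointsMaps_toAddMonoidHom b))
    (hinj : ∀ z : W.sha,
      shaMap φ.toAddMonoidHom φ.equivariant φ.hasLocalPointsMaps_toAddMonoidHom z = 0 → z = 0)
    (hND : ∀ x : W'.sha,
      shaMap ψ.toAddMonoidHom ψ.equivariant ψ.hasLocalPointsMaps_toAddMonoidHom x = 0 →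
        (∀ y : W'.sha,
          shaMap ψ.toAddMonoidHom ψ.equivariant ψ.hasLocalPointsMaps_toAddMonoidHom y = 0 →
            B' x y = 0) → x = 0) :
    BSDp W p := by
  refine Typed.bsdp_of_shaAn_unit_of_noPTorsion W p hGZK hr hq hv ?_
  intro x hx
  refine sha_torsion_eq_zero_of_adjoint_of_nondegenerate φ ψ hψφ B B' hadj hinj hND x ?_
  rwa [hdeg]

/-- **Both curves, class-free.** Under the hypotheses of
`bsdp_of_shaMap_injective_of_casselsTate_nondegenerate'` with both curves globally minimal, also
`BSDp W′ p` (Cassels' isogeny invariance at `r_an ≤ 1`, `bsdp_iff_of_isIsogenous`; binders `hmod`,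
`hCassels`). For sha-2's X3 pairs this reads e.g. `BSD(19950cv1, 5) ∧ BSD(19950cv2, 5)`.
[cite: MilneADT2006, Ch. I Thm. 7.3] [cite: Miller2011LMS, §1 Def. 1.1] -/
theorem bsdp_pair_of_shaMap_injective_of_casselsTate_nondegenerate'
    (hGZK : rank_eq_analyticRank_of_analyticRank_le_one)
    (hmod : hasEntireLFunction_rat) (hCassels : bsdRHS_eq_of_isIsogenous)
    (W W' : WeierstrassCurve ℚ) [W.IsElliptic] [W'.IsElliptic] [W.IsGloballyMinimal]
    [W'.IsGloballyMinimal] (p : ℕ) [Fact p.Prime] (hr : W.analyticRank ≤ 1)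
    {q : ℚ} (hq : shaAn W = (q : ℂ)) (hv : padicValRat p q = 0)
    (φ : Isogeny W W') (ψ : Isogeny W' W)
    (hψφ : ∀ P : W.geomPoints, ψ (φ P) = (φ.degree : ℤ) • P) (hdeg : φ.degree = p)
    (B : W.sha →+ W.sha →+ AddCircle (1 : ℚ)) (B' : W'.sha →+ W'.sha →+ AddCircle (1 : ℚ))
    (hadj : ∀ a b, B' (shaMap φ.toAddMonoidHom φ.equivariant φ.hasLocalPointsMaps_toAddMonoidHom a) b =
      B a (shaMap ψ.toAddMonoidHom ψ.equivariant ψ.hasLocalPointsMaps_toAddMonoidHom b))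
    (hinj : ∀ z : W.sha,
      shaMap φ.toAddMonoidHom φ.equivariant φ.hasLocalPointsMaps_toAddMonoidHom z = 0 → z = 0)
    (hND : ∀ x : W'.sha,
      shaMap ψ.toAddMonoidHom ψ.equivariant ψ.hasLocalPointsMaps_toAddMonoidHom x = 0 →
        (∀ y : W'.sha,
          shaMap ψ.toAddMonoidHom ψ.equivariant ψ.hasLocalPointsMaps_toAddMonoidHom y = 0 →
            B' x y = 0) → x = 0) :
    BSDp W p ∧ BSDp W' p := by
  have hB : BSDp W p := bsdp_of_shaMap_injective_of_casselsTate_nondegenerate' hGZK W W' p hr hq hv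
    φ ψ hψφ hdeg B B' hadj hinj hND
  refine ⟨hB, ?_⟩
  have hiso : IsIsogenous W W' := ⟨φ⟩
  exact (Summit.BirchSwinnertonDyer.BirchSwinnertonDyer.Theorems.Rank1ResidualX1Isogeny.bsdp_iff_of_isIsogenous
    hGZK hmod hCassels W W' hiso p hr).mp hB

/-- **Class-free, pairings from the named fact** `exists_casselsTate_pairing_adjoint ℚ` (Milne *ADT* I
Prop. 6.9, Rem. 6.10(a),(b), Thm. 6.13(a); Cassels 1962/65), certificate over every such pair of pairings.
[cite: MilneADT2006, Ch. I Prop. 6.9, Remark 6.10(a), Thm. 6.13(a)] [cite: Miller2011LMS, §1 Def. 1.1] -/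
theorem bsdp_of_casselsTate_adjoint_certificate'
    (hGZK : rank_eq_analyticRank_of_analyticRank_le_one) (hCT : exists_casselsTate_pairing_adjoint ℚ)
    (W W' : WeierstrassCurve ℚ) [W.IsElliptic] [W'.IsElliptic]
    (p : ℕ) [Fact p.Prime] (hr : W.analyticRank ≤ 1)
    {q : ℚ} (hq : shaAn W = (q : ℂ)) (hv : padicValRat p q = 0)
    (φ : Isogeny W W') (ψ : Isogeny W' W)
    (hψφ : ∀ P : W.geomPoints, ψ (φ P) = (φ.degree : ℤ) • P) (hdeg : φ.degree = p)
    (hinj : ∀ z : W.sha,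
      shaMap φ.toAddMonoidHom φ.equivariant φ.hasLocalPointsMaps_toAddMonoidHom z = 0 → z = 0)
    (hcert : ∀ (B : W.sha →+ W.sha →+ AddCircle (1 : ℚ)) (B' : W'.sha →+ W'.sha →+ AddCircle (1 : ℚ)),
      (∀ x, B x x = 0) → (∀ x, (∀ y, B x y = 0) ↔ x ∈ AddSubgroup.divisibleElements W.sha) →
      (∀ x, B' x x = 0) → (∀ x, (∀ y, B' x y = 0) ↔ x ∈ AddSubgroup.divisibleElements W'.sha) →
      (∀ a b, B' (shaMap φ.toAddMonoidHom φ.equivariant φ.hasLocalPointsMaps_toAddMonoidHom a) b =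
        B a (shaMap ψ.toAddMonoidHom ψ.equivariant ψ.hasLocalPointsMaps_toAddMonoidHom b)) →
      ∀ x : W'.sha,
        shaMap ψ.toAddMonoidHom ψ.equivariant ψ.hasLocalPointsMaps_toAddMonoidHom x = 0 →
          (∀ y : W'.sha,
            shaMap ψ.toAddMonoidHom ψ.equivariant ψ.hasLocalPointsMaps_toAddMonoidHom y = 0 →
              B' x y = 0) → x = 0) :
    BSDp W p := by
  obtain ⟨B, B', hBalt, hBker, hB'alt, hB'ker, hadj⟩ := hCT W W' φ ψ hψφ
  exact bsdp_of_shaMap_injective_of_casselsTate_nondegenerate' hGZK W W' p hr hq hv φ ψ hψφ hdeg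
    B B' hadj hinj (hcert B B' hBalt hBker hB'alt hB'ker hadj)

end ClassFree

end Summit.BirchSwinnertonDyer.Rank1Residual.X1.CasselsTateIsogenyCertificate

end
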